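import Summits.AnomalousDissipation.AnomalousDissipation.Theorems.ImpulseGridGridThesisStubAcdcDesignCalculus
import Summits.AnomalousDissipation.AnomalousDissipation.Theorems.ImpulseGridGridThesisStubAcdcDesignIntegrals
import Summits.AnomalousDissipation.AnomalousDissipation.Theorems.ImpulseGridBoundedEnergyNoLeakGridStubAbsorbingBallGrid

/-!
# Birth skeleton — crux `ImpulseGrid.AcdcEnergyNoLeak` (stmt-AnomalousDissipation-18237), line `birth`

Child 2 of the AC/DC split of `GridThesis` (crux strategist of stmt-1770, 2026-08-17).  The crux: for
all `(m, A, θ, c)` the explicit AC/DC grid force `Φ•G` admits `ν_j → 0⁺`, drift data `∫u₀ⱼ = c e₀`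
and global Leray–Hopf solutions with j-UNIFORMLY bounded mean energy and NO Leray–Hopf LEAKAGE in the
mean.  Leray–Hopf-level tight factorisation (the shape of the `BoundedEnergyNoLeakGrid` line v5,
specialised to the AC/DC class):

* `stub_acdcUniformEnergyDriftFamilies` ("UEDF-ACDC"; OPEN, existence — turbulent saturation
  `Re ~ Gr^{1/2}` for this 4-parameter force family: `ν`-uniform limsup-mean energy of SOME
  vanishing-viscosity Leray–Hopf drift family; Doering–Foias 2002 §3, FMRT (13.11)).  It is the
  AC/DC slice of the v5 residual UEDF of stmt-14350 and lies OUTSIDE that residual's landed hardness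
  pins (p118293/p119194 use `Φ ≡ 1` with a shear pattern; here `θ > 0`, `G` cellular, and in the drift
  frame the force is the steady cellular `G` plus a SWEPT AC part).  NECESSARY for the crux (drop the
  no-leak clause).
* `stub_noMeanLeakageCapped` (OPEN, law — Leray–Hopf mean energy equality at fixed `ν > 0` for a
  forward-capped global solution under a smooth div-free mean-zero steady force; verbatim the v5 stub
  of the stmt-14350 line, implied by the existing crux `Correlation.NoMeanLeakage`, stmt-14265; known
  for regular classes only, FMRT p.71, CCFS 2008).
* landed: the forward kinetic-energy cap at `ν > 0` (`BoundedEnergyNoLeakGrid.stub_absorbingBallGrid`,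
  p110941) and the design facts (`stub_acdcDesignCalculus`/`Integrals`: `Φ•G` smooth, div-free,
  mean-zero).
* `AcdcEnergyNoLeak_of` — composition.

Neither open stub is the crux or a zeroth-law witness: UEDF-ACDC has no no-leak / dissipation
content, the no-leak law has no existence content.  The regular door (bounded ETERNAL CLASSICAL drift
states ⇒ crux with no-leak for free; `boundedEnergyNoLeakGrid_of_regularDriftStates` p109901 pattern)
is the alternative one-conjecture reading.
-/

noncomputable section

open MeasureTheory Set Filter Topology
open scoped InnerProductSpace RealInnerProductSpace

-- `Summit.<Summit>.<Problem>` is the tree's mandated summit-side namespace (CONVENTIONS §2).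
set_option linter.dupNamespace false

namespace Summit.AnomalousDissipation.AnomalousDissipation.Cruxes.AcdcEnergyNoLeak.Birth

open Literature.Analysis.FunctionSpaces Literature.Analysis.FunctionSpaces.Torus
open Literature.Analysis.FluidPDE Literature.Analysis.FluidPDE.Torus
open Summit.AnomalousDissipation.AnomalousDissipation.Theses.ImpulseGrid
open Summit.AnomalousDissipation.AnomalousDissipation.Theorems

local notation "𝕋³" => UnitAddTorus (Fin 3)
local notation "E³" => EuclideanSpace ℝ (Fin 3)

/-! ### Stub 1 (existence): uniform-energy drift families for the AC/DC grid -/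

/-- **Stub (OPEN, existence; conjecture-grade): UEDF-ACDC.** [folklore] -/
theorem stub_acdcUniformEnergyDriftFamilies :
    ∀ (m : ℕ) (A θ c : ℝ), 1 ≤ m → 0 < A → 0 < θ → 0 < c →
      ∀ (Φ : 𝕋³ → ℝ) (G : 𝕋³ → E³),
        Φ = (fun x => 1 + 2 * θ * (UnitAddTorus.mFourier (Pi.single (0 : Fin 3) (1 : ℤ)) x).re) →
        G = (fun x => A • (stokesMode ![(0 : ℤ), (m : ℤ), (m : ℤ)]
              (EuclideanSpace.single (1 : Fin 3) (1 : ℝ) - EuclideanSpace.single (2 : Fin 3) (1 : ℝ)) false x +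
            stokesMode ![(0 : ℤ), (m : ℤ), -(m : ℤ)]
              (EuclideanSpace.single (1 : Fin 3) (1 : ℝ) + EuclideanSpace.single (2 : Fin 3) (1 : ℝ)) false x)) →
        ∃ (ν : ℕ → ℝ) (u₀ : ℕ → 𝕋³ → E³) (u : ℕ → ℝ → 𝕋³ → E³),
          (∀ j, 0 < ν j) ∧ Tendsto ν atTop (𝓝 0) ∧
          (∀ j, IsGlobalLerayHopf (ν j) (fun _ => fun x => Φ x • G x) (u₀ j) (u j)) ∧
          (∀ j, ∫ x, u₀ j x = c • EuclideanSpace.single 0 1) ∧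
          (∃ E : ℝ, ∀ j, meanEnergy (u j) ≤ E) := by
  sorry

/-! ### Stub 2 (law): no Leray–Hopf leakage in the mean at fixed viscosity -/

/-- **Stub (OPEN, law): Leray–Hopf mean energy equality for forward-capped global solutions under a
smooth divergence-free mean-zero steady force** (≡ the v5 stub of the stmt-14350 line; implied by
`Correlation.NoMeanLeakage`, stmt-14265). [folklore] -/
theorem stub_noMeanLeakageCapped :
    ∀ (ν : ℝ) (f : 𝕋³ → E³) (u₀ : 𝕋³ → E³) (u : ℝ → 𝕋³ → E³),
    0 < ν → IsSmooth f → IsDivFree f → HasZeroMean f → IsGlobalLerayHopf ν (fun _ => f) u₀ u →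
    (∃ C : ℝ, ∀ t : ℝ, 0 ≤ t → kineticEnergy (u t) ≤ C) →
    longTimeAvgSup (fun t => ∫ x, inner ℝ (f x) (u t x)) ≤ meanDissipation ν u := by
  sorry

/-! ### Composition: the crux BY NAME -/

/-- **`AcdcEnergyNoLeak` from the two stubs** (sorry-free modulo the stubs): the family from
UEDF-ACDC; `Φ•G` smooth / div-free / mean-zero from the design calculus; the forward cap at
`ν_j > 0` from the landed absorbing ball; no-leak from the law. [folklore] -/
theorem AcdcEnergyNoLeak_of :
    Summit.AnomalousDissipation.AnomalousDissipation.Theses.ImpulseGrid.AcdcEnergyNoLeak := by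
  have hU := stub_acdcUniformEnergyDriftFamilies
  have hNL := stub_noMeanLeakageCapped
  intro m A θ c hm hA hθ hc Φ G hΦd hGd
  obtain ⟨ν, u₀, u, hν, hν0, hLH, hdrift, E, hE⟩ := hU m A θ c hm hA hθ hc Φ G hΦd hGd
  -- design facts: `Φ • G` is smooth, divergence free and of zero mean
  set Ψ : 𝕋³ → ℝ := fun x => θ / Real.pi * (UnitAddTorus.mFourier (Pi.single (0 : Fin 3) (1 : ℤ)) x).im
    with hΨd
  set C : 𝕋³ → E³ := fun x => (UnitAddTorus.mFourier (Pi.single (0 : Fin 3) (1 : ℤ)) x).re • G x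
    with hCd
  set S : 𝕋³ → E³ := fun x => (UnitAddTorus.mFourier (Pi.single (0 : Fin 3) (1 : ℤ)) x).im • G x
    with hSd
  obtain ⟨-, -, -, -, -, -, -, -, hfs, hfd, -⟩ :=
    stub_acdcDesignCalculus m A θ Φ Ψ G C S hΦd hΨd hGd hCd hSd hm hA hθ
  obtain ⟨-, hfm, -⟩ := stub_acdcDesignIntegrals m A θ Φ Ψ G C S hΦd hΨd hGd hCd hSd hm hA hθ
  -- forward kinetic-energy caps at `ν_j > 0` (landed absorbing ball)
  have hcap : ∀ j, ∃ C₀ : ℝ, ∀ t : ℝ, 0 ≤ t → kineticEnergy (u j t) ≤ C₀ := fun j => by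
    obtain ⟨C₀, -, hC₀⟩ := BoundedEnergyNoLeakGrid.stub_absorbingBallGrid (ν j) (fun x => Φ x • G x)
      (u₀ j) (u j) (hν j) hfs hfm (hLH j)
    exact ⟨C₀, hC₀⟩
  exact ⟨ν, u₀, u, hν, hν0, hLH, hdrift, ⟨E, hE⟩, fun j =>
    hNL (ν j) (fun x => Φ x • G x) (u₀ j) (u j) (hν j) hfs hfd hfm (hLH j) (hcap j)⟩

end Summit.AnomalousDissipation.AnomalousDissipation.Cruxes.AcdcEnergyNoLeak.Birth

end
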